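import Literature.Probability.Moments.StochasticTraceEstimator
import HarnessLib

/-!
# Hutch++: the projector split `tr A = tr(QᵀAQ) + tr((I−QQᵀ)A(I−QQᵀ))` for ANY orthonormal `Q`,
# unbiasedness of the deflate-then-estimate estimator conditional on `Q`, its conditional variance,
# and "multiplying by a projection can only decrease the Frobenius norm"

Topic `Probability/Moments`; sequel of `StochasticTraceEstimator.lean` (`traceEst`, `avgTraceEst`,
`integral_avgTraceEst`, `variance_avgTraceEst`) and companion of `DeflatedTraceEstimator.lean` /
`HutchPlusPlusVariance.lean`, which treat EXACT eigenvector deflation only ("HONEST SCOPE: exact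
eigenvectors only … no inexact deflation").  Here the deflating subspace is ARBITRARY — any `Q`
with orthonormal columns (in Hutch++ the orthonormalised sketch `Q = orth(AS)`; in lattice practice
approximate low modes) — and the statements are the algebraic and in-the-mean facts that hold for
every such `Q`.  PUBLISHED RESULTS with our proofs; one definition (`hutchPP`, the estimator of
Algorithm 1 conditional on `Q`), no named fact (D-0026).

HONEST FRAMING: exact (Metropolis-corrected) sampling algorithms for lattice gauge theory;
figures of merit are autocorrelation/cost numbers at stated couplings and volumes; no
continuum-physics claim.

## Source (read on the materialised text) and what is taken

R. A. Meyer, C. Musco, C. Musco, D. P. Woodruff, *Hutch++: Optimal Stochastic Trace Estimation*,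
SOSA 2021, 142–155 = arXiv:2010.09649 [MeyerMuscoMuscoWoodruff2021] (held text
`paper:arxiv-2010.09649`, chunks p0003, p0006, p0009): §3 (Algorithm 1, Hutch++): "we separate `A`
into its projection onto the subspace spanned by `Q`, and onto that subspace's orthogonal
compliment, writing `tr(A) = tr(QQᵀAQQᵀ) + tr((I − QQᵀ)A(I − QQᵀ))`. By the cyclic property of
the trace, the first term is equal to `tr(QᵀAQ)`, which is computed exactly … The second term is
approximated using Hutchinson's estimator", Algorithm 1 line 5: "return
`Hutch++(A) = tr(QᵀAQ) + (3/m) tr(Gᵀ(I − QQᵀ)A(I − QQᵀ)G)`"; proof of Theorem 1 (p0006): "since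
`Q` is orthogonal, `(I − QQᵀ)` is a projection matrix, so `(I − QQᵀ) = (I − QQᵀ)²`. This fact,
along with the cyclic property of the trace, gives `tr(Ã) = tr(QᵀAQ)` and `tr(Δ) = tr(A(I − QQᵀ))`,
and thus `tr(Ã) + tr(Δ) = tr(A)` … Furthermore, since multiplying by a projection matrix can only
decrease Frobenius norm, `‖Δ‖_F² ≤ ‖A(I − QQᵀ)‖_F²`"; App. A proof of Theorem 4 (p0009): "it
suffices to prove that, for any fixed `Q`, `E[H̃(A) | Q] = tr(A)`. This follows from cyclic
property of trace, the fact that `I − QQᵀ` is idempotent, and [Hutchinson's unbiasedness]: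
`E[tr(QᵀAQ) + H_ℓ((I − QQᵀ)A(I − QQᵀ)) | Q] = tr(QᵀAQ) + tr((I − QQᵀ)A(I − QQᵀ)) = tr(A)`.
Then, to bound the variance, we appeal to the Law of Total Variance".

## What is formalised (real `A : Matrix n n ℝ`; `Q : Matrix n k ℝ` with `QᵀQ = 1`; all proved)

* `trace_eq_of_idempotent` — for ANY idempotent `P`: `tr A = tr(PAP) + tr((1−P)A(1−P))`
  (cyclicity + `P² = P`); `trace_proj_conj` (`tr(QQᵀAQQᵀ) = tr(QᵀAQ)`),
  **`trace_eq_trace_conj_add_trace_deflate`** — the printed split.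
* `hutchPP A Q L Z := tr(QᵀAQ) + (1/L)Σ_l z_lᵀ Δ z_l`, `Δ = (1−QQᵀ)A(1−QQᵀ)` (Algorithm 1, line 5,
  conditional on `Q`); **`integral_hutchPP`** — `E[Hutch++ | Q] = tr A` for every i.i.d. unit
  noise (App. A); **`variance_hutchPP`** — `E[(Hutch++ − tr A)² | Q]` = the `L`-probe Hutchinson
  variance of `Δ` (the first term of the law of total variance).
* `sum_sq_proj_mul_add` — Pythagoras for a symmetric idempotent `P`:
  `‖PM‖_F² + ‖(1−P)M‖_F² = ‖M‖_F²`; **`sum_sq_deflate_le`** — "multiplying by a projection matrix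
  can only decrease Frobenius norm": `‖Δ‖_F² ≤ ‖A(1−QQᵀ)‖_F² ≤ ‖A‖_F²`.

NOT formalised: the sketching bound `‖A − QQᵀA‖_F² ≤ 2‖A − A_k‖_F²` (randomised range finder)
and hence Theorems 1/4's `(1 ± ε)` guarantees; those are what `HutchPlusPlusVariance.lean` also
leaves out.  Context (cell pub-lqcd, HOME/R2-SCOPE.md §3 E2 N2 / E9): deflated Hutchinson
estimates of `tr f(D†D)` with INEXACT low modes are unbiased conditional on the deflation space and
their variance is the Hutchinson variance of the deflated remainder — exactness in the mean of the
ESTIMATE, not of `e^{estimate}` (N2 stands).  No run, no figure of merit of ours.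
-/

noncomputable section

open Finset
open scoped Matrix

namespace Literature.Probability.Moments

namespace StochasticTrace

namespace HutchPlusPlus

open _root_.MeasureTheory _root_.ProbabilityTheory

variable {n : Type*} [Fintype n] [DecidableEq n] {k : Type*} [Fintype k] [DecidableEq k]

/-! ## The projector split of the trace -/

/-- For any IDEMPOTENT `P` (`P² = P`): `tr A = tr(PAP) + tr((1 − P)A(1 − P))` — "the fact that
`I − QQᵀ` is idempotent, and the cyclic property of the trace".
[cite: MeyerMuscoMuscoWoodruff2021, §3 proof of Theorem 1 (`tr(Ã) + tr(Δ) = tr(A)`)] -/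
theorem trace_eq_of_idempotent (A P : Matrix n n ℝ) (hP : P * P = P) :
    A.trace = (P * A * P).trace + ((1 - P) * A * (1 - P)).trace := by
  have hQ : (1 - P) * (1 - P) = 1 - P := by
    rw [Matrix.sub_mul, Matrix.one_mul, Matrix.mul_sub, Matrix.mul_one, hP, sub_self, sub_zero]
  have h1 : (P * A * P).trace = (P * A).trace := by
    rw [Matrix.trace_mul_comm, ← Matrix.mul_assoc, hP]
  have h2 : ((1 - P) * A * (1 - P)).trace = ((1 - P) * A).trace := by
    rw [Matrix.trace_mul_comm, ← Matrix.mul_assoc, hQ]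
  rw [h1, h2, ← Matrix.trace_add, ← Matrix.add_mul, add_sub_cancel, Matrix.one_mul]

omit [DecidableEq n] in
/-- `QQᵀ` is idempotent when `QᵀQ = 1`. [cite: MeyerMuscoMuscoWoodruff2021, §3 proof of Theorem 1
("`(I − QQᵀ)` is a projection matrix")] -/
theorem proj_mul_proj (Q : Matrix n k ℝ) (hQ : Qᵀ * Q = 1) :
    Q * Qᵀ * (Q * Qᵀ) = Q * Qᵀ := by
  rw [Matrix.mul_assoc, ← Matrix.mul_assoc Qᵀ, hQ, Matrix.one_mul]

omit [DecidableEq n] in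
/-- "By the cyclic property of the trace, the first term is equal to `tr(QᵀAQ)`":
`tr(QQᵀ A QQᵀ) = tr(QᵀAQ)`. [cite: MeyerMuscoMuscoWoodruff2021, §3 (paragraph after Theorem 1)] -/
theorem trace_proj_conj (A : Matrix n n ℝ) (Q : Matrix n k ℝ) (hQ : Qᵀ * Q = 1) :
    (Q * Qᵀ * A * (Q * Qᵀ)).trace = (Qᵀ * A * Q).trace := by
  have e : Q * Qᵀ * A * (Q * Qᵀ) = (Q * (Qᵀ * A * Q)) * Qᵀ := by
    simp only [Matrix.mul_assoc]
  rw [e, Matrix.trace_mul_comm, ← Matrix.mul_assoc, hQ, Matrix.one_mul]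

omit [DecidableEq k] in
/-- The DEFLATED REMAINDER `Δ = (I − QQᵀ) A (I − QQᵀ)` of Algorithm 1.
[cite: MeyerMuscoMuscoWoodruff2021, §3 Algorithm 1 (line 5) and proof of Theorem 1 (`Δ`)] -/
def deflate (A : Matrix n n ℝ) (Q : Matrix n k ℝ) : Matrix n n ℝ :=
  ((1 : Matrix n n ℝ) - Q * Qᵀ) * A * ((1 : Matrix n n ℝ) - Q * Qᵀ)

/-- **THE HUTCH++ SPLIT** for any `Q` with orthonormal columns:
`tr(A) = tr(QᵀAQ) + tr((I − QQᵀ)A(I − QQᵀ))`.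
[cite: MeyerMuscoMuscoWoodruff2021, §3 ("writing `tr(A) = tr(QQᵀAQQᵀ) + tr((I − QQᵀ)A(I − QQᵀ))`")
and proof of Theorem 1] -/
theorem trace_eq_trace_conj_add_trace_deflate (A : Matrix n n ℝ) (Q : Matrix n k ℝ)
    (hQ : Qᵀ * Q = 1) : A.trace = (Qᵀ * A * Q).trace + (deflate A Q).trace := by
  rw [← trace_proj_conj A Q hQ, deflate]
  exact trace_eq_of_idempotent A (Q * Qᵀ) (proj_mul_proj Q hQ)

/-! ## The estimator conditional on `Q`: unbiasedness and variance -/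

omit [DecidableEq k] in
/-- **Hutch++ conditional on the deflation basis `Q`**: `tr(QᵀAQ) + (1/L) Σ_l z_lᵀ Δ z_l`
("return `Hutch++(A) = tr(QᵀAQ) + (3/m) tr(Gᵀ(I − QQᵀ)A(I − QQᵀ)G)`", the `L = m/3` columns of `G`
being the probes `l ↦ Z(·, l)`). [cite: MeyerMuscoMuscoWoodruff2021, §3 Algorithm 1 (line 5)] -/
def hutchPP (A : Matrix n n ℝ) (Q : Matrix n k ℝ) (L : ℕ) (Z : n × Fin L → ℝ) : ℝ :=
  (Qᵀ * A * Q).trace + avgTraceEst (deflate A Q) L Z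

/-- The estimation error of Hutch++ is the Hutchinson error on the remainder `Δ`.
[cite: MeyerMuscoMuscoWoodruff2021, App. A proof of Theorem 4 (first display)] -/
theorem hutchPP_sub_trace (A : Matrix n n ℝ) (Q : Matrix n k ℝ) (hQ : Qᵀ * Q = 1) (L : ℕ)
    (Z : n × Fin L → ℝ) :
    hutchPP A Q L Z - A.trace = avgTraceEst (deflate A Q) L Z - (deflate A Q).trace := by
  rw [hutchPP, trace_eq_trace_conj_add_trace_deflate A Q hQ]
  ring

section Moments

variable {μ : Measure ℝ} [IsProbabilityMeasure μ] (hμ : IsUnitNoise μ)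
include hμ

/-- The single-probe quadratic form is integrable under an i.i.d. unit noise (finite sum of
products of two coordinates). [cite: AvronToledo2011, §2 Lemma 2.1 (the expectation exists)] -/
theorem integrable_traceEst {m : Type*} [Fintype m] [DecidableEq m] (B : Matrix m m ℝ) :
    Integrable (fun z => traceEst B z) (Measure.pi fun _ : m => μ) := by
  unfold traceEst
  refine integrable_finsetSum _ fun i _ => integrable_finsetSum _ fun j _ => ?_
  exact (integrable_coord_mul hμ i j).const_mul (B i j)

/-- The `L`-probe average is integrable. [cite: AvronToledo2011, §4] -/
theorem integrable_avgTraceEst (B : Matrix n n ℝ) (L : ℕ) :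
    Integrable (fun Z => avgTraceEst B L Z) (Measure.pi fun _ : n × Fin L => μ) := by
  unfold avgTraceEst
  simp_rw [sum_traceEst_eq_blockDiagonal]
  exact (integrable_traceEst hμ _).div_const _

/-- **UNBIASEDNESS CONDITIONAL ON `Q`**: "for any fixed `Q`, `E[H̃(A) | Q] = tr(A)`. This follows
from cyclic property of trace, the fact that `I − QQᵀ` is idempotent, and [Hutchinson's
unbiasedness]". [cite: MeyerMuscoMuscoWoodruff2021, App. A proof of Theorem 4 (first display)] -/
theorem integral_hutchPP (A : Matrix n n ℝ) (Q : Matrix n k ℝ) (hQ : Qᵀ * Q = 1) {L : ℕ}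
    (hL : 0 < L) :
    ∫ Z, hutchPP A Q L Z ∂(Measure.pi fun _ : n × Fin L => μ) = A.trace := by
  unfold hutchPP
  rw [integral_add (integrable_const _) (integrable_avgTraceEst hμ _ L),
    integral_avgTraceEst hμ _ hL, trace_eq_trace_conj_add_trace_deflate A Q hQ]
  simp

/-- **VARIANCE CONDITIONAL ON `Q`** (the first term of the law of total variance): for a unit
noise with fourth moment `m₄`, `E[(Hutch++ − tr A)² | Q] =
[(m₄ − 1) Σᵢ Δᵢᵢ² + Σ_{i≠j} Δᵢⱼ(Δᵢⱼ + Δⱼᵢ)] / L` — Hutchinson's variance of the REMAINDER `Δ`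
only. [cite: MeyerMuscoMuscoWoodruff2021, App. A proof of Theorem 4 ("to bound the variance, we
appeal to the Law of Total Variance")] -/
theorem variance_hutchPP (A : Matrix n n ℝ) (Q : Matrix n k ℝ) (hQ : Qᵀ * Q = 1) {L : ℕ}
    (hL : 0 < L) :
    ∫ Z, (hutchPP A Q L Z - A.trace) ^ 2 ∂(Measure.pi fun _ : n × Fin L => μ) =
      ((∫ x, x ^ 4 ∂μ - 1) * ∑ i, deflate A Q i i ^ 2 +
        ∑ i, ∑ j, offd (deflate A Q) i j * (deflate A Q i j + deflate A Q j i)) / L := by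
  simp_rw [hutchPP_sub_trace A Q hQ]
  exact variance_avgTraceEst hμ _ hL

end Moments

/-! ## "Multiplying by a projection matrix can only decrease Frobenius norm" -/

omit [DecidableEq n] in
/-- `Σ_{ij} X_ij² = tr(XᵀX)` (private bookkeeping). [folklore] -/
private theorem sum_sq_eq_trace {m : Type*} [Fintype m] (X : Matrix m n ℝ) :
    ∑ i, ∑ j, X i j ^ 2 = (Xᵀ * X).trace := by
  rw [Matrix.trace, Finset.sum_comm]
  refine Finset.sum_congr rfl fun j _ => ?_
  rw [Matrix.diag_apply, Matrix.mul_apply]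
  refine Finset.sum_congr rfl fun i _ => ?_
  rw [Matrix.transpose_apply, pow_two]

/-- **Pythagoras for a symmetric idempotent `P`**: `‖PM‖_F² + ‖(1 − P)M‖_F² = ‖M‖_F²`.
[cite: MeyerMuscoMuscoWoodruff2021, §3 proof of Theorem 1 ("multiplying by a projection matrix can
only decrease Frobenius norm")] -/
theorem sum_sq_proj_mul_add {m : Type*} [Fintype m] (P : Matrix n n ℝ) (hPt : Pᵀ = P)
    (hP : P * P = P) (M : Matrix n m ℝ) :
    ∑ i, ∑ j, (P * M) i j ^ 2 + ∑ i, ∑ j, (((1 : Matrix n n ℝ) - P) * M) i j ^ 2 =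
      ∑ i, ∑ j, M i j ^ 2 := by
  have hQt : (1 - P)ᵀ = 1 - P := by rw [Matrix.transpose_sub, Matrix.transpose_one, hPt]
  have hQ : (1 - P) * (1 - P) = 1 - P := by
    rw [Matrix.sub_mul, Matrix.one_mul, Matrix.mul_sub, Matrix.mul_one, hP, sub_self, sub_zero]
  rw [sum_sq_eq_trace, sum_sq_eq_trace, sum_sq_eq_trace, Matrix.transpose_mul,
    Matrix.transpose_mul, hPt, hQt, ← Matrix.trace_add]
  congr 1
  have e1 : Mᵀ * P * (P * M) = Mᵀ * (P * P) * M := by simp only [Matrix.mul_assoc]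
  have e2 : Mᵀ * (1 - P) * ((1 - P) * M) = Mᵀ * ((1 - P) * (1 - P)) * M := by
    simp only [Matrix.mul_assoc]
  rw [e1, e2, hP, hQ, ← Matrix.add_mul, ← Matrix.mul_add, add_sub_cancel, Matrix.mul_one]

/-- Left multiplication by a symmetric idempotent does not increase the Frobenius norm:
`‖(1 − P)M‖_F² ≤ ‖M‖_F²`. [cite: MeyerMuscoMuscoWoodruff2021, §3 proof of Theorem 1] -/
theorem sum_sq_compl_mul_le {m : Type*} [Fintype m] (P : Matrix n n ℝ) (hPt : Pᵀ = P)
    (hP : P * P = P) (M : Matrix n m ℝ) :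
    ∑ i, ∑ j, (((1 : Matrix n n ℝ) - P) * M) i j ^ 2 ≤ ∑ i, ∑ j, M i j ^ 2 := by
  rw [← sum_sq_proj_mul_add P hPt hP M]
  have h : 0 ≤ ∑ i, ∑ j, (P * M) i j ^ 2 :=
    Finset.sum_nonneg fun i _ => Finset.sum_nonneg fun j _ => sq_nonneg _
  linarith

/-- Right multiplication likewise: `‖M(1 − P)‖_F² ≤ ‖M‖_F²` (transpose of the previous).
[cite: MeyerMuscoMuscoWoodruff2021, §3 proof of Theorem 1] -/
theorem sum_sq_mul_compl_le {m : Type*} [Fintype m] (P : Matrix n n ℝ) (hPt : Pᵀ = P)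
    (hP : P * P = P) (M : Matrix m n ℝ) :
    ∑ i, ∑ j, (M * ((1 : Matrix n n ℝ) - P)) i j ^ 2 ≤ ∑ i, ∑ j, M i j ^ 2 := by
  have h := sum_sq_compl_mul_le P hPt hP Mᵀ
  have hQt : ((1 : Matrix n n ℝ) - P)ᵀ = 1 - P := by
    rw [Matrix.transpose_sub, Matrix.transpose_one, hPt]
  have e : ((1 : Matrix n n ℝ) - P) * Mᵀ = (M * ((1 : Matrix n n ℝ) - P))ᵀ := by
    rw [Matrix.transpose_mul, hQt]
  rw [e] at h
  simp only [Matrix.transpose_apply] at h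
  rw [Finset.sum_comm] at h
  conv_rhs at h => rw [Finset.sum_comm]
  exact h

/-- **`‖Δ‖_F² ≤ ‖A(I − QQᵀ)‖_F² ≤ ‖A‖_F²`** for `Δ = (I − QQᵀ)A(I − QQᵀ)`, `QᵀQ = 1` ("since
multiplying by a projection matrix can only decrease Frobenius norm,
`‖Δ‖_F² ≤ ‖A(I − QQᵀ)‖_F²`"). [cite: MeyerMuscoMuscoWoodruff2021, §3 proof of Theorem 1] -/
theorem sum_sq_deflate_le (A : Matrix n n ℝ) (Q : Matrix n k ℝ) (hQ : Qᵀ * Q = 1) :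
    ∑ i, ∑ j, deflate A Q i j ^ 2 ≤ ∑ i, ∑ j, (A * ((1 : Matrix n n ℝ) - Q * Qᵀ)) i j ^ 2 ∧
      ∑ i, ∑ j, (A * ((1 : Matrix n n ℝ) - Q * Qᵀ)) i j ^ 2 ≤ ∑ i, ∑ j, A i j ^ 2 := by
  have hPt : (Q * Qᵀ)ᵀ = Q * Qᵀ := by rw [Matrix.transpose_mul, Matrix.transpose_transpose]
  have hP := proj_mul_proj Q hQ
  refine ⟨?_, sum_sq_mul_compl_le _ hPt hP A⟩
  have e : deflate A Q = ((1 : Matrix n n ℝ) - Q * Qᵀ) * (A * ((1 : Matrix n n ℝ) - Q * Qᵀ)) := by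
    rw [deflate, Matrix.mul_assoc]
  rw [e]
  exact sum_sq_compl_mul_le _ hPt hP _

end HutchPlusPlus

end StochasticTrace

end Literature.Probability.Moments
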